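import Summits.CriticalPhenomena.PercolationContinuityZ3.Theorems.PercNearOneGluingNoHeavyQuantAD3FrechetPairs
import Summits.CriticalPhenomena.PercolationContinuityZ3.Theorems.PercNearOneGluingNoHeavyQuantConvAtoms
import HarnessLib

/-!
# QUANT lane R8, T-DEC, ROUTE 2: the PIECEWISE Fréchet template — a triple component whose two mean-`T` pair pieces are admissible multiplies
# like two pairs (`AD3FrechetCell ⟹` those H⊗L3 / L2⊗L3 / L3⊗L3 instances of `AD3ProdCell`)

builds on p205010 (kernel theorem, internal audit signed; external expert review pending)

Support file (`--supports stmt-CriticalPhenomena-4575`), QUANT lane, LEAD seat prim-quant-lead (gen 35), rung R8; continues `…QuantAD3Frechet` /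
`…QuantAD3FrechetPairs`.  No definitions, no sorries, standard axioms.

A three-atom law `τ = {s₁,s₂,s₃; p}` of mean `T` is the mixture of its two mean-`T` PAIR pieces (`{s₁,s₃}`, `{s₂,s₃}` when `s₂ ≤ T`; `{s₁,s₂}`, `{s₁,s₃}` when
`T < s₂`; typer g30's `triple_eq_twoPairs_low/high`), and `lconv` is linear in each factor, so `τ ∗ ω = w·(A ∗ ω) + (1−w)·(B ∗ ω)` and AD3⁺ decompositions mix
(`ad3Decomp_mixture`).  Hence, by `ad3Decomp_lconv_pairs_of_frechetCell`: **if both pair pieces of an admissible triple are themselves ADMISSIBLE pairs, its product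
with an admissible pair (and, iterating, with another such triple) is AD3⁺ given `AD3FrechetCell`.**  EXACT CENSUS (lead g35 explore/frechet.py): all 13 536 sampled
pair⊗pair sub-products whose pieces are heavy / admissible-light (including pieces of triples): 0 failures of the Fréchet laws.  NOT COVERED (honest): triples with an
INADMISSIBLE light piece (5–25 % of triples by origin) — there the piecewise template fails in 24–45 % of instances and no fixed-piece template is known
(memo quant/prim-quant-lead-g35/FOR-PROVERS-AD3PROD-FRECHET.md §5); the product is AD3⁺ in every exact instance nonetheless.

* `ad3Decomp_lconv_mix_left` — AD3⁺ of `A ∗ ω` and `B ∗ ω` ⟹ AD3⁺ of `(wA + (1−w)B) ∗ ω`.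
* `ad3Decomp_lconv_TR_low_of_pieces`, `ad3Decomp_lconv_TR_high_of_pieces` — the triple cases, `ω` arbitrary.
* **`ad3Decomp_lconv_TR_TP_low_of_frechetCell`, `ad3Decomp_lconv_TR_TP_high_of_frechetCell`** — triple (pieces admissible) ⊗ admissible pair, from the cell;
  commuted forms `ad3Decomp_lconv_TP_TR_low/high_of_frechetCell`; `ad3Decomp_lconv_TR_TR_low_low_of_frechetCell` (triple ⊗ triple, one shape).
HONEST STATUS: `AD3FrechetCell`, `AD3ProdCell`, `TreeBuiltAD3`, `FarTreeRow` OPEN; RATE class log\* / honest sentence unchanged.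

[this work]; Fréchet–Hoeffding [folklore].  The gluing rows served [cite: KozmaNitzan2024, Conjecture 3 (p. 15)]; product measure [cite: Grimmett1999, §1.3 p. 10].
-/

noncomputable section

namespace Summit.CriticalPhenomena.PercolationContinuityZ3.Theorems

namespace Quant

open Finset

/-- two-point law notation `TP[lo, hi, g, h] = g·[h = hi] + (1 − g)·[h = lo]` (as in the lane's other files). -/
local notation3 "TP[" lo ", " hi ", " g ", " h "]" =>
  (g : ℝ) * (if (h : ℕ) = (hi : ℕ) then (1 : ℝ) else 0) + (1 - (g : ℝ)) * (if (h : ℕ) = (lo : ℕ) then (1 : ℝ) else 0)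

/-- three-atom law notation `TR[s₁, s₂, s₃, p₁, p₂, p₃, h] = p₁·[h = s₁] + p₂·[h = s₂] + p₃·[h = s₃]`. -/
local notation3 "TR[" s₁ ", " s₂ ", " s₃ ", " p₁ ", " p₂ ", " p₃ ", " h "]" =>
  (p₁ : ℝ) * (if (h : ℕ) = (s₁ : ℕ) then (1 : ℝ) else 0) + (p₂ : ℝ) * (if (h : ℕ) = (s₂ : ℕ) then (1 : ℝ) else 0)
    + (p₃ : ℝ) * (if (h : ℕ) = (s₃ : ℕ) then (1 : ℝ) else 0)

namespace LawDec

/-- **mixtures in the first factor**: if `A ∗ ω` and `B ∗ ω` are AD3⁺ at `(y,q,T,M₁+M₂)` and `w₁, w₂ ≥ 0`, `w₁ + w₂ = 1`, so is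
`(w₁·A + w₂·B) ∗ ω`. [this work] -/
theorem ad3Decomp_lconv_mix_left (y q T w₁ w₂ : ℝ) (M₁ M₂ : ℕ) (A B ω : ℕ → ℝ) (hw₁ : 0 ≤ w₁) (hw₂ : 0 ≤ w₂) (hw : w₁ + w₂ = 1)
    (hA : AD3Decomp y q T (M₁ + M₂) (lconv M₁ M₂ A ω)) (hB : AD3Decomp y q T (M₁ + M₂) (lconv M₁ M₂ B ω)) :
    AD3Decomp y q T (M₁ + M₂) (lconv M₁ M₂ (fun k => w₁ * A k + w₂ * B k) ω) := by
  have e : (fun k => w₁ * A k + w₂ * B k) = fun k => ∑ b : Bool, (cond b w₁ w₂) * (cond b A B) k := by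
    funext k; rw [Fintype.sum_bool]; simp only [cond_true, cond_false]
  rw [e]
  refine ad3Decomp_mixture y q T (M₁ + M₂) _ (fun b : Bool => cond b w₁ w₂) (fun b => lconv M₁ M₂ (cond b A B) ω)
    (fun b => ?_) ?_ (fun h => lconv_sum_left M₁ M₂ ω _ _ h) (fun b _ => ?_)
  · cases b
    · simpa only [cond_false] using hw₂
    · simpa only [cond_true] using hw₁
  · rw [Fintype.sum_bool]; simpa only [cond_true, cond_false] using hw
  · cases b
    · simpa only [cond_false] using hB
    · simpa only [cond_true] using hA

/-- **triple with `s₂ ≤ T < s₃`**: `τ = {s₁,s₂,s₃; p} = w₁·{s₁,s₃;γ₁₃} + w₂·{s₂,s₃;γ₂₃}` (`γᵢ₃ = (T−sᵢ)/(s₃−sᵢ)`, `w₁ = p₁(s₃−s₁)/(s₃−T)`,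
`w₂ = p₂(s₃−s₂)/(s₃−T)`; typer g30's `triple_eq_twoPairs_low`); if both piece-products with `ω` are AD3⁺, so is `τ ∗ ω`. [this work] -/
theorem ad3Decomp_lconv_TR_low_of_pieces (y q T₁ T p₁ p₂ p₃ : ℝ) (M₁ M₂ s₁ s₂ s₃ : ℕ) (ω : ℕ → ℝ)
    (h12 : s₁ < s₂) (h23 : s₂ < s₃) (hp₁ : 0 ≤ p₁) (hp₂ : 0 ≤ p₂) (hp : p₁ + p₂ + p₃ = 1)
    (hT : p₁ * (s₁ : ℝ) + p₂ * (s₂ : ℝ) + p₃ * (s₃ : ℝ) = T₁) (hT3 : T₁ < (s₃ : ℝ))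
    (hA : AD3Decomp y q T (M₁ + M₂) (lconv M₁ M₂ (fun k => TP[s₁, s₃, (T₁ - s₁) / ((s₃ : ℝ) - s₁), k]) ω))
    (hB : AD3Decomp y q T (M₁ + M₂) (lconv M₁ M₂ (fun k => TP[s₂, s₃, (T₁ - s₂) / ((s₃ : ℝ) - s₂), k]) ω)) :
    AD3Decomp y q T (M₁ + M₂) (lconv M₁ M₂ (fun k => TR[s₁, s₂, s₃, p₁, p₂, p₃, k]) ω) := by
  have hs12 : (s₁ : ℝ) < s₂ := by exact_mod_cast h12
  have hs23 : (s₂ : ℝ) < s₃ := by exact_mod_cast h23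
  have d3T : (0 : ℝ) < (s₃ : ℝ) - T₁ := by linarith
  have hw₁ : 0 ≤ p₁ * ((s₃ : ℝ) - s₁) / ((s₃ : ℝ) - T₁) := div_nonneg (mul_nonneg hp₁ (by linarith)) d3T.le
  have hw₂ : 0 ≤ p₂ * ((s₃ : ℝ) - s₂) / ((s₃ : ℝ) - T₁) := div_nonneg (mul_nonneg hp₂ (by linarith)) d3T.le
  have hw : p₁ * ((s₃ : ℝ) - s₁) / ((s₃ : ℝ) - T₁) + p₂ * ((s₃ : ℝ) - s₂) / ((s₃ : ℝ) - T₁) = 1 := by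
    have e : p₁ * ((s₃ : ℝ) - s₁) + p₂ * ((s₃ : ℝ) - s₂) = (s₃ : ℝ) - T₁ := by linear_combination (s₃ : ℝ) * hp - hT
    rw [← add_div, e, div_self (ne_of_gt d3T)]
  have e : (fun k : ℕ => TR[s₁, s₂, s₃, p₁, p₂, p₃, k]) = fun k => p₁ * ((s₃ : ℝ) - s₁) / ((s₃ : ℝ) - T₁) *
      TP[s₁, s₃, (T₁ - s₁) / ((s₃ : ℝ) - s₁), k] + p₂ * ((s₃ : ℝ) - s₂) / ((s₃ : ℝ) - T₁) * TP[s₂, s₃, (T₁ - s₂) / ((s₃ : ℝ) - s₂), k] := by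
    funext k
    exact triple_eq_twoPairs_low p₁ p₂ p₃ T₁ s₁ s₂ s₃ h12 h23 hp hT hT3 k
  rw [e]
  exact ad3Decomp_lconv_mix_left y q T _ _ M₁ M₂ _ _ ω hw₁ hw₂ hw hA hB

/-- **triple with `s₁ < T`** (used when `T ≤ s₂`): `τ = w₁·{s₁,s₂;γ₁₂} + w₂·{s₁,s₃;γ₁₃}` (`w₁ = p₂(s₂−s₁)/(T−s₁)`, `w₂ = p₃(s₃−s₁)/(T−s₁)`;
`triple_eq_twoPairs_high`); if both piece-products with `ω` are AD3⁺, so is `τ ∗ ω`. [this work] -/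
theorem ad3Decomp_lconv_TR_high_of_pieces (y q T₁ T p₁ p₂ p₃ : ℝ) (M₁ M₂ s₁ s₂ s₃ : ℕ) (ω : ℕ → ℝ)
    (h12 : s₁ < s₂) (h23 : s₂ < s₃) (hp₂ : 0 ≤ p₂) (hp₃ : 0 ≤ p₃) (hp : p₁ + p₂ + p₃ = 1)
    (hT : p₁ * (s₁ : ℝ) + p₂ * (s₂ : ℝ) + p₃ * (s₃ : ℝ) = T₁) (hT1 : (s₁ : ℝ) < T₁)
    (hA : AD3Decomp y q T (M₁ + M₂) (lconv M₁ M₂ (fun k => TP[s₁, s₂, (T₁ - s₁) / ((s₂ : ℝ) - s₁), k]) ω))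
    (hB : AD3Decomp y q T (M₁ + M₂) (lconv M₁ M₂ (fun k => TP[s₁, s₃, (T₁ - s₁) / ((s₃ : ℝ) - s₁), k]) ω)) :
    AD3Decomp y q T (M₁ + M₂) (lconv M₁ M₂ (fun k => TR[s₁, s₂, s₃, p₁, p₂, p₃, k]) ω) := by
  have hs12 : (s₁ : ℝ) < s₂ := by exact_mod_cast h12
  have hs23 : (s₂ : ℝ) < s₃ := by exact_mod_cast h23
  have dT1 : (0 : ℝ) < T₁ - s₁ := by linarith
  have hw₁ : 0 ≤ p₂ * ((s₂ : ℝ) - s₁) / (T₁ - s₁) := div_nonneg (mul_nonneg hp₂ (by linarith)) dT1.le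
  have hw₂ : 0 ≤ p₃ * ((s₃ : ℝ) - s₁) / (T₁ - s₁) := div_nonneg (mul_nonneg hp₃ (by linarith)) dT1.le
  have hw : p₂ * ((s₂ : ℝ) - s₁) / (T₁ - s₁) + p₃ * ((s₃ : ℝ) - s₁) / (T₁ - s₁) = 1 := by
    have e : p₂ * ((s₂ : ℝ) - s₁) + p₃ * ((s₃ : ℝ) - s₁) = T₁ - s₁ := by linear_combination hT - (s₁ : ℝ) * hp
    rw [← add_div, e, div_self (ne_of_gt dT1)]
  have e : (fun k : ℕ => TR[s₁, s₂, s₃, p₁, p₂, p₃, k]) = fun k => p₂ * ((s₂ : ℝ) - s₁) / (T₁ - s₁) *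
      TP[s₁, s₂, (T₁ - s₁) / ((s₂ : ℝ) - s₁), k] + p₃ * ((s₃ : ℝ) - s₁) / (T₁ - s₁) * TP[s₁, s₃, (T₁ - s₁) / ((s₃ : ℝ) - s₁), k] := by
    funext k
    exact triple_eq_twoPairs_high p₁ p₂ p₃ T₁ s₁ s₂ s₃ h12 h23 hp hT hT1 k
  rw [e]
  exact ad3Decomp_lconv_mix_left y q T _ _ M₁ M₂ _ _ ω hw₁ hw₂ hw hA hB

/-- **`AD3FrechetCell ⟹` (triple with `s₂ ≤ T₁`, BOTH pair pieces admissible) ⊗ (admissible pair) is AD3⁺.**  Top-affordability of the pieces is that of the triple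
(same mean, tops `≤ s₃ ≤ M₁`). [this work] -/
theorem ad3Decomp_lconv_TR_TP_low_of_frechetCell (hFC : AD3FrechetCell) (y q T₁ p₁ p₂ p₃ γ : ℝ) (M₁ M₂ s₁ s₂ s₃ lo hi : ℕ)
    (hy0 : 0 < y) (hyq : y < q) (hq1 : q ≤ 1)
    (h12 : s₁ < s₂) (h23 : s₂ < s₃) (h3 : s₃ ≤ M₁) (hp₁ : 0 ≤ p₁) (hp₂ : 0 ≤ p₂) (hp : p₁ + p₂ + p₃ = 1)
    (hT : p₁ * (s₁ : ℝ) + p₂ * (s₂ : ℝ) + p₃ * (s₃ : ℝ) = T₁) (hs2 : (s₂ : ℝ) ≤ T₁) (hT3 : T₁ < (s₃ : ℝ))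
    (hta₁ : y * (M₁ : ℝ) ≤ q * T₁)
    (hA : ∀ j', j' < M₁ → DECAt y j' M₁ (gate (fun k => TP[s₁, s₃, (T₁ - s₁) / ((s₃ : ℝ) - s₁), k]) q))
    (hB : ∀ j', j' < M₁ → DECAt y j' M₁ (gate (fun k => TP[s₂, s₃, (T₁ - s₂) / ((s₃ : ℝ) - s₂), k]) q))
    (hlohi : lo ≤ hi) (hhi : hi ≤ M₂) (hγ0 : 0 ≤ γ) (hγ1 : γ ≤ 1) (hta₂ : y * (M₂ : ℝ) ≤ q * ((lo : ℝ) + ((hi : ℝ) - lo) * γ))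
    (hC : ∀ j', j' < M₂ → DECAt y j' M₂ (gate (fun k => TP[lo, hi, γ, k]) q)) :
    AD3Decomp y q (T₁ + ((lo : ℝ) + ((hi : ℝ) - lo) * γ)) (M₁ + M₂)
      (lconv M₁ M₂ (fun k => TR[s₁, s₂, s₃, p₁, p₂, p₃, k]) (fun k => TP[lo, hi, γ, k])) := by
  have hs12 : (s₁ : ℝ) < s₂ := by exact_mod_cast h12
  have hs23 : (s₂ : ℝ) < s₃ := by exact_mod_cast h23
  have d13 : (0 : ℝ) < (s₃ : ℝ) - s₁ := by linarith
  have d23 : (0 : ℝ) < (s₃ : ℝ) - s₂ := by linarith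
  have m13 : (s₁ : ℝ) + ((s₃ : ℝ) - s₁) * ((T₁ - s₁) / ((s₃ : ℝ) - s₁)) = T₁ := by field_simp; ring
  have m23 : (s₂ : ℝ) + ((s₃ : ℝ) - s₂) * ((T₁ - s₂) / ((s₃ : ℝ) - s₂)) = T₁ := by field_simp; ring
  refine ad3Decomp_lconv_TR_low_of_pieces y q T₁ _ p₁ p₂ p₃ M₁ M₂ s₁ s₂ s₃ _ h12 h23 hp₁ hp₂ hp hT hT3 ?_ ?_
  · have h := ad3Decomp_lconv_pairs_of_frechetCell hFC y q ((T₁ - s₁) / ((s₃ : ℝ) - s₁)) γ M₁ M₂ s₁ s₃ lo hi hy0 hyq hq1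
      (h12.trans h23).le h3 hlohi hhi (div_nonneg (by linarith) d13.le) ((div_le_one d13).2 (by linarith)) hγ0 hγ1
      (by rw [m13]; exact hta₁) hta₂ hA hC
    rwa [m13] at h
  · have h := ad3Decomp_lconv_pairs_of_frechetCell hFC y q ((T₁ - s₂) / ((s₃ : ℝ) - s₂)) γ M₁ M₂ s₂ s₃ lo hi hy0 hyq hq1
      h23.le h3 hlohi hhi (div_nonneg (by linarith) d23.le) ((div_le_one d23).2 (by linarith)) hγ0 hγ1
      (by rw [m23]; exact hta₁) hta₂ hB hC
    rwa [m23] at h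

/-- **`AD3FrechetCell ⟹` (triple with `T₁ ≤ s₂`, BOTH pair pieces admissible) ⊗ (admissible pair) is AD3⁺.** [this work] -/
theorem ad3Decomp_lconv_TR_TP_high_of_frechetCell (hFC : AD3FrechetCell) (y q T₁ p₁ p₂ p₃ γ : ℝ) (M₁ M₂ s₁ s₂ s₃ lo hi : ℕ)
    (hy0 : 0 < y) (hyq : y < q) (hq1 : q ≤ 1)
    (h12 : s₁ < s₂) (h23 : s₂ < s₃) (h3 : s₃ ≤ M₁) (hp₂ : 0 ≤ p₂) (hp₃ : 0 ≤ p₃) (hp : p₁ + p₂ + p₃ = 1)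
    (hT : p₁ * (s₁ : ℝ) + p₂ * (s₂ : ℝ) + p₃ * (s₃ : ℝ) = T₁) (hT1 : (s₁ : ℝ) < T₁) (hs2 : T₁ ≤ (s₂ : ℝ))
    (hta₁ : y * (M₁ : ℝ) ≤ q * T₁)
    (hA : ∀ j', j' < M₁ → DECAt y j' M₁ (gate (fun k => TP[s₁, s₂, (T₁ - s₁) / ((s₂ : ℝ) - s₁), k]) q))
    (hB : ∀ j', j' < M₁ → DECAt y j' M₁ (gate (fun k => TP[s₁, s₃, (T₁ - s₁) / ((s₃ : ℝ) - s₁), k]) q))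
    (hlohi : lo ≤ hi) (hhi : hi ≤ M₂) (hγ0 : 0 ≤ γ) (hγ1 : γ ≤ 1) (hta₂ : y * (M₂ : ℝ) ≤ q * ((lo : ℝ) + ((hi : ℝ) - lo) * γ))
    (hC : ∀ j', j' < M₂ → DECAt y j' M₂ (gate (fun k => TP[lo, hi, γ, k]) q)) :
    AD3Decomp y q (T₁ + ((lo : ℝ) + ((hi : ℝ) - lo) * γ)) (M₁ + M₂)
      (lconv M₁ M₂ (fun k => TR[s₁, s₂, s₃, p₁, p₂, p₃, k]) (fun k => TP[lo, hi, γ, k])) := by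
  have hs12 : (s₁ : ℝ) < s₂ := by exact_mod_cast h12
  have hs23 : (s₂ : ℝ) < s₃ := by exact_mod_cast h23
  have d12 : (0 : ℝ) < (s₂ : ℝ) - s₁ := by linarith
  have d13 : (0 : ℝ) < (s₃ : ℝ) - s₁ := by linarith
  have m12 : (s₁ : ℝ) + ((s₂ : ℝ) - s₁) * ((T₁ - s₁) / ((s₂ : ℝ) - s₁)) = T₁ := by field_simp; ring
  have m13 : (s₁ : ℝ) + ((s₃ : ℝ) - s₁) * ((T₁ - s₁) / ((s₃ : ℝ) - s₁)) = T₁ := by field_simp; ring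
  refine ad3Decomp_lconv_TR_high_of_pieces y q T₁ _ p₁ p₂ p₃ M₁ M₂ s₁ s₂ s₃ _ h12 h23 hp₂ hp₃ hp hT hT1 ?_ ?_
  · have h := ad3Decomp_lconv_pairs_of_frechetCell hFC y q ((T₁ - s₁) / ((s₂ : ℝ) - s₁)) γ M₁ M₂ s₁ s₂ lo hi hy0 hyq hq1
      h12.le (h23.le.trans h3) hlohi hhi (div_nonneg (by linarith) d12.le) ((div_le_one d12).2 (by linarith)) hγ0 hγ1
      (by rw [m12]; exact hta₁) hta₂ hA hC
    rwa [m12] at h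
  · have h := ad3Decomp_lconv_pairs_of_frechetCell hFC y q ((T₁ - s₁) / ((s₃ : ℝ) - s₁)) γ M₁ M₂ s₁ s₃ lo hi hy0 hyq hq1
      (h12.trans h23).le h3 hlohi hhi (div_nonneg (by linarith) d13.le) ((div_le_one d13).2 (by linarith)) hγ0 hγ1
      (by rw [m13]; exact hta₁) hta₂ hB hC
    rwa [m13] at h


/-! ### The commuted forms and a triple ⊗ triple instance -/

/-- `AD3Decomp` of a convolution transported along `lconv_comm` (means and tops commuted). [this work] -/
theorem ad3Decomp_of_lconv_comm (y q T₁ T₂ : ℝ) (M₁ M₂ : ℕ) (ω₁ ω₂ : ℕ → ℝ)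
    (h : AD3Decomp y q (T₂ + T₁) (M₂ + M₁) (lconv M₂ M₁ ω₂ ω₁)) :
    AD3Decomp y q (T₁ + T₂) (M₁ + M₂) (lconv M₁ M₂ ω₁ ω₂) := by
  rw [lconv_comm, add_comm T₁, Nat.add_comm M₁]
  exact h

/-- **`AD3FrechetCell ⟹` (admissible pair) ⊗ (triple with `s₂ ≤ T₂`, both pair pieces admissible) is AD3⁺** (commuted form). [this work] -/
theorem ad3Decomp_lconv_TP_TR_low_of_frechetCell (hFC : AD3FrechetCell) (y q T₂ p₁ p₂ p₃ γ : ℝ) (M₁ M₂ s₁ s₂ s₃ lo hi : ℕ)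
    (hy0 : 0 < y) (hyq : y < q) (hq1 : q ≤ 1)
    (hlohi : lo ≤ hi) (hhi : hi ≤ M₁) (hγ0 : 0 ≤ γ) (hγ1 : γ ≤ 1) (hta₁ : y * (M₁ : ℝ) ≤ q * ((lo : ℝ) + ((hi : ℝ) - lo) * γ))
    (hC : ∀ j', j' < M₁ → DECAt y j' M₁ (gate (fun k => TP[lo, hi, γ, k]) q))
    (h12 : s₁ < s₂) (h23 : s₂ < s₃) (h3 : s₃ ≤ M₂) (hp₁ : 0 ≤ p₁) (hp₂ : 0 ≤ p₂) (hp : p₁ + p₂ + p₃ = 1)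
    (hT : p₁ * (s₁ : ℝ) + p₂ * (s₂ : ℝ) + p₃ * (s₃ : ℝ) = T₂) (hs2 : (s₂ : ℝ) ≤ T₂) (hT3 : T₂ < (s₃ : ℝ))
    (hta₂ : y * (M₂ : ℝ) ≤ q * T₂)
    (hA : ∀ j', j' < M₂ → DECAt y j' M₂ (gate (fun k => TP[s₁, s₃, (T₂ - s₁) / ((s₃ : ℝ) - s₁), k]) q))
    (hB : ∀ j', j' < M₂ → DECAt y j' M₂ (gate (fun k => TP[s₂, s₃, (T₂ - s₂) / ((s₃ : ℝ) - s₂), k]) q)) :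
    AD3Decomp y q (((lo : ℝ) + ((hi : ℝ) - lo) * γ) + T₂) (M₁ + M₂)
      (lconv M₁ M₂ (fun k => TP[lo, hi, γ, k]) (fun k => TR[s₁, s₂, s₃, p₁, p₂, p₃, k])) :=
  ad3Decomp_of_lconv_comm y q _ T₂ M₁ M₂ _ _
    (ad3Decomp_lconv_TR_TP_low_of_frechetCell hFC y q T₂ p₁ p₂ p₃ γ M₂ M₁ s₁ s₂ s₃ lo hi hy0 hyq hq1 h12 h23 h3 hp₁ hp₂ hp hT hs2 hT3
      hta₂ hA hB hlohi hhi hγ0 hγ1 hta₁ hC)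

/-- **`AD3FrechetCell ⟹` (admissible pair) ⊗ (triple with `T₂ ≤ s₂`, both pair pieces admissible) is AD3⁺** (commuted form). [this work] -/
theorem ad3Decomp_lconv_TP_TR_high_of_frechetCell (hFC : AD3FrechetCell) (y q T₂ p₁ p₂ p₃ γ : ℝ) (M₁ M₂ s₁ s₂ s₃ lo hi : ℕ)
    (hy0 : 0 < y) (hyq : y < q) (hq1 : q ≤ 1)
    (hlohi : lo ≤ hi) (hhi : hi ≤ M₁) (hγ0 : 0 ≤ γ) (hγ1 : γ ≤ 1) (hta₁ : y * (M₁ : ℝ) ≤ q * ((lo : ℝ) + ((hi : ℝ) - lo) * γ))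
    (hC : ∀ j', j' < M₁ → DECAt y j' M₁ (gate (fun k => TP[lo, hi, γ, k]) q))
    (h12 : s₁ < s₂) (h23 : s₂ < s₃) (h3 : s₃ ≤ M₂) (hp₂ : 0 ≤ p₂) (hp₃ : 0 ≤ p₃) (hp : p₁ + p₂ + p₃ = 1)
    (hT : p₁ * (s₁ : ℝ) + p₂ * (s₂ : ℝ) + p₃ * (s₃ : ℝ) = T₂) (hT1 : (s₁ : ℝ) < T₂) (hs2 : T₂ ≤ (s₂ : ℝ))
    (hta₂ : y * (M₂ : ℝ) ≤ q * T₂)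
    (hA : ∀ j', j' < M₂ → DECAt y j' M₂ (gate (fun k => TP[s₁, s₂, (T₂ - s₁) / ((s₂ : ℝ) - s₁), k]) q))
    (hB : ∀ j', j' < M₂ → DECAt y j' M₂ (gate (fun k => TP[s₁, s₃, (T₂ - s₁) / ((s₃ : ℝ) - s₁), k]) q)) :
    AD3Decomp y q (((lo : ℝ) + ((hi : ℝ) - lo) * γ) + T₂) (M₁ + M₂)
      (lconv M₁ M₂ (fun k => TP[lo, hi, γ, k]) (fun k => TR[s₁, s₂, s₃, p₁, p₂, p₃, k])) :=
  ad3Decomp_of_lconv_comm y q _ T₂ M₁ M₂ _ _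
    (ad3Decomp_lconv_TR_TP_high_of_frechetCell hFC y q T₂ p₁ p₂ p₃ γ M₂ M₁ s₁ s₂ s₃ lo hi hy0 hyq hq1 h12 h23 h3 hp₂ hp₃ hp hT hT1 hs2
      hta₂ hA hB hlohi hhi hγ0 hγ1 hta₁ hC)

/-- **`AD3FrechetCell ⟹` triple ⊗ triple, both in the `s₂ ≤ T` shape with all four pair pieces admissible, is AD3⁺** (the other three shape
combinations are identical with `…_high_of_pieces` / `…TP_TR_high…`). [this work] -/
theorem ad3Decomp_lconv_TR_TR_low_low_of_frechetCell (hFC : AD3FrechetCell) (y q T₁ T₂ p₁ p₂ p₃ r₁ r₂ r₃ : ℝ)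
    (M₁ M₂ s₁ s₂ s₃ u₁ u₂ u₃ : ℕ) (hy0 : 0 < y) (hyq : y < q) (hq1 : q ≤ 1)
    (h12 : s₁ < s₂) (h23 : s₂ < s₃) (h3 : s₃ ≤ M₁) (hp₁ : 0 ≤ p₁) (hp₂ : 0 ≤ p₂) (hp : p₁ + p₂ + p₃ = 1)
    (hT : p₁ * (s₁ : ℝ) + p₂ * (s₂ : ℝ) + p₃ * (s₃ : ℝ) = T₁) (hs2 : (s₂ : ℝ) ≤ T₁) (hT3 : T₁ < (s₃ : ℝ))
    (hta₁ : y * (M₁ : ℝ) ≤ q * T₁)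
    (hA : ∀ j', j' < M₁ → DECAt y j' M₁ (gate (fun k => TP[s₁, s₃, (T₁ - s₁) / ((s₃ : ℝ) - s₁), k]) q))
    (hB : ∀ j', j' < M₁ → DECAt y j' M₁ (gate (fun k => TP[s₂, s₃, (T₁ - s₂) / ((s₃ : ℝ) - s₂), k]) q))
    (hu12 : u₁ < u₂) (hu23 : u₂ < u₃) (hu3 : u₃ ≤ M₂) (hr₁ : 0 ≤ r₁) (hr₂ : 0 ≤ r₂) (hr : r₁ + r₂ + r₃ = 1)
    (hT' : r₁ * (u₁ : ℝ) + r₂ * (u₂ : ℝ) + r₃ * (u₃ : ℝ) = T₂) (hu2 : (u₂ : ℝ) ≤ T₂) (hT3' : T₂ < (u₃ : ℝ))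
    (hta₂ : y * (M₂ : ℝ) ≤ q * T₂)
    (hA' : ∀ j', j' < M₂ → DECAt y j' M₂ (gate (fun k => TP[u₁, u₃, (T₂ - u₁) / ((u₃ : ℝ) - u₁), k]) q))
    (hB' : ∀ j', j' < M₂ → DECAt y j' M₂ (gate (fun k => TP[u₂, u₃, (T₂ - u₂) / ((u₃ : ℝ) - u₂), k]) q)) :
    AD3Decomp y q (T₁ + T₂) (M₁ + M₂)
      (lconv M₁ M₂ (fun k => TR[s₁, s₂, s₃, p₁, p₂, p₃, k]) (fun k => TR[u₁, u₂, u₃, r₁, r₂, r₃, k])) := by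
  have hs12 : (s₁ : ℝ) < s₂ := by exact_mod_cast h12
  have hs23 : (s₂ : ℝ) < s₃ := by exact_mod_cast h23
  have d13 : (0 : ℝ) < (s₃ : ℝ) - s₁ := by linarith
  have d23 : (0 : ℝ) < (s₃ : ℝ) - s₂ := by linarith
  have m13 : (s₁ : ℝ) + ((s₃ : ℝ) - s₁) * ((T₁ - s₁) / ((s₃ : ℝ) - s₁)) = T₁ := by field_simp; ring
  have m23 : (s₂ : ℝ) + ((s₃ : ℝ) - s₂) * ((T₁ - s₂) / ((s₃ : ℝ) - s₂)) = T₁ := by field_simp; ring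
  refine ad3Decomp_lconv_TR_low_of_pieces y q T₁ _ p₁ p₂ p₃ M₁ M₂ s₁ s₂ s₃ _ h12 h23 hp₁ hp₂ hp hT hT3 ?_ ?_
  · have h := ad3Decomp_lconv_TP_TR_low_of_frechetCell hFC y q T₂ r₁ r₂ r₃ ((T₁ - s₁) / ((s₃ : ℝ) - s₁)) M₁ M₂ u₁ u₂ u₃ s₁ s₃
      hy0 hyq hq1 (h12.trans h23).le h3 (div_nonneg (by linarith) d13.le) ((div_le_one d13).2 (by linarith)) (by rw [m13]; exact hta₁) hA
      hu12 hu23 hu3 hr₁ hr₂ hr hT' hu2 hT3' hta₂ hA' hB'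
    rwa [m13] at h
  · have h := ad3Decomp_lconv_TP_TR_low_of_frechetCell hFC y q T₂ r₁ r₂ r₃ ((T₁ - s₂) / ((s₃ : ℝ) - s₂)) M₁ M₂ u₁ u₂ u₃ s₂ s₃
      hy0 hyq hq1 h23.le h3 (div_nonneg (by linarith) d23.le) ((div_le_one d23).2 (by linarith)) (by rw [m23]; exact hta₁) hB
      hu12 hu23 hu3 hr₁ hr₂ hr hT' hu2 hT3' hta₂ hA' hB'
    rwa [m23] at h

end LawDec

end Quant

end Summit.CriticalPhenomena.PercolationContinuityZ3.Theorems
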